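import Summits.MatrixMultiplication.OmegaCensus.SmallFormats.MatMulM22ManyRankOne
import HarnessLib

/-!
# ω-census family (a): Alekseev's Lemma 12 mechanism, part 3 — the OUTPUT FUNCTIONAL `θ_c` is computed by the rank-one frame members alone (any field)

Cell `pub-omega` (unit `pub-omega-tensor`, gen 38), topic `Summits/MatrixMultiplication/OmegaCensus` (sub-folder
`SmallFormats`). Framing (verbatim): lottery ticket; floor = certified bounds/negative ranges. HONEST FRAMING: structural lemma about
bilinear algorithms for `⟨m,2,2⟩` (≅ `⟨2,2,m⟩`) over an ARBITRARY field; NEW mathematics of the cell; NOT a bound on any rank; nothing here is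
a bound on `ω`.

Setting of parts 1–2 (`MatMulM22ManyRankOne`, `…Count`): frame `F`, `c, r ∈ k^m` with `R_c := ∑_{p∈I} κc_p D_p^2 = ∑_j r_j P_j`
(`κc_p = ∑_i c_i κ_i^p`). Define the output functional `θ_c(w) := ∑_i c_i w(i,0) + ∑_j r_j w(j,1)` on `k^{m×2}` (census `⟨2,2,m⟩`:
`M ↦ row₀(M)·c + row₁(M)·r`). By the equations (1) of the source (`E1`–`E4`), `∑_t θ_c(w_t) D_t^1 = Q_c = ∑_{p∈I} κc_p D_p^1` and
`∑_t θ_c(w_t) D_t^2 = ∑_j r_j P_j = ∑_{p∈I} κc_p D_p^2`. Hence (`theta_eq_of_indep`), if the products `f_t ⊗ g_t` are linearly independent (stated as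
injectivity of `z ↦ (∑ z_t D_t^1, ∑ z_t D_t^2)`; automatic for an algorithm of minimal length, since a dependency removes a term) then `θ_c(w_t) = κc_t` for `t ∈ I` and `θ_c(w_t) = 0` for
`t ∉ I`: the output functional `θ_c` is computed EXACTLY by the frame members in the support of `κc`, which (part 1, `qvec_par_of_ne_zero`)
have RANK-ONE X-forms when `κc`, `hh` vanish off `I'` (`theta_ne_zero_imp`). With part 2's `dim C ≥ m − 2e − g` this gives `≥ m − 2e − g`
independent output functionals annihilating the output coefficients of every term whose X-form is invertible (tensor g38 memo LAW-3M3 §4, §6).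
-/

namespace Summit.MatrixMultiplication.OmegaCensus.SmallFormats

open Finset Module
open Literature.Computability.AlgebraicComplexity
open Literature.Computability.AlgebraicComplexity.Alekseev2015

namespace Lemma12Gen

variable {k : Type*} [Field k] {m : ℕ} {ι : Type*} [Fintype ι] [DecidableEq ι]
variable {β : BilinComp (mulBilin k m 2 2) ι} (F : Frame β)

/-- `∑_t θ_c(w_t) D_t^1 = ∑_{p ∈ I} κc_p D_p^1` ((1): `∑_t w_t(i,0) D_t^1 = P_i`, `∑_t w_t(j,1) D_t^1 = 0`). -/
theorem sum_theta_smul_D1 (c r : Fin m → k) :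
    ∑ t, (∑ i, c i * β.w t i 0 + ∑ j, r j * β.w t j 1) • D1 β t = ∑ p ∈ F.I, (∑ i, c i * F.κ i p) • D1 β p := by
  rw [← sum_rowMap_eq_sum_kc F c]
  have e1 : ∀ t, (∑ i, c i * β.w t i 0 + ∑ j, r j * β.w t j 1) • D1 β t =
      ∑ i, (c i * β.w t i 0) • D1 β t + ∑ j, (r j * β.w t j 1) • D1 β t := fun t => by
    rw [add_smul, Finset.sum_smul, Finset.sum_smul]
  rw [Finset.sum_congr rfl fun t _ => e1 t, Finset.sum_add_distrib, Finset.sum_comm]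
  conv_lhs => arg 2; rw [Finset.sum_comm]
  have h0 : ∑ j, ∑ t, (r j * β.w t j 1) • D1 β t = 0 := by
    refine Finset.sum_eq_zero fun j _ => ?_
    rw [show ∑ t, (r j * β.w t j 1) • D1 β t = r j • ∑ t, β.w t j 1 • D1 β t by
      rw [Finset.smul_sum]; exact Finset.sum_congr rfl fun t _ => by rw [smul_smul], E3, smul_zero]
  rw [h0, add_zero]
  refine Finset.sum_congr rfl fun i _ => ?_
  rw [← E1 β i, Finset.smul_sum]
  exact Finset.sum_congr rfl fun t _ => by rw [smul_smul]

omit [DecidableEq ι] in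
/-- `∑_t θ_c(w_t) D_t^2 = ∑_j r_j P_j` ((1): `∑_t w_t(i,0) D_t^2 = 0`, `∑_t w_t(j,1) D_t^2 = P_j`). -/
theorem sum_theta_smul_D2 (c r : Fin m → k) :
    ∑ t, (∑ i, c i * β.w t i 0 + ∑ j, r j * β.w t j 1) • D2 β t = ∑ j, r j • rowMap k m j := by
  have e1 : ∀ t, (∑ i, c i * β.w t i 0 + ∑ j, r j * β.w t j 1) • D2 β t =
      ∑ i, (c i * β.w t i 0) • D2 β t + ∑ j, (r j * β.w t j 1) • D2 β t := fun t => by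
    rw [add_smul, Finset.sum_smul, Finset.sum_smul]
  rw [Finset.sum_congr rfl fun t _ => e1 t, Finset.sum_add_distrib, Finset.sum_comm]
  conv_lhs => arg 2; rw [Finset.sum_comm]
  have h0 : ∑ i, ∑ t, (c i * β.w t i 0) • D2 β t = 0 := by
    refine Finset.sum_eq_zero fun i _ => ?_
    rw [show ∑ t, (c i * β.w t i 0) • D2 β t = c i • ∑ t, β.w t i 0 • D2 β t by
      rw [Finset.smul_sum]; exact Finset.sum_congr rfl fun t _ => by rw [smul_smul], E2, smul_zero]
  rw [h0, zero_add]
  refine Finset.sum_congr rfl fun j _ => ?_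
  rw [← E4 β j, Finset.smul_sum]
  exact Finset.sum_congr rfl fun t _ => by rw [smul_smul]

/-- **`θ_c` is computed by the frame members in the support of `κc`.** If `R_c = ∑_{p∈I} κc_p D_p^2 = ∑_j r_j P_j` and the products
`f_t ⊗ g_t` are linearly independent (stated block-wise as injectivity: two coefficient vectors giving the same combinations of the first
blocks `D_t^1` AND of the second blocks `D_t^2` are equal), then `θ_c(w_t) = κc_t` for `t ∈ I` and `θ_c(w_t) = 0` for `t ∉ I`. -/
theorem theta_eq_of_indep (c r : Fin m → k)
    (hR : ∑ p ∈ F.I, (∑ i, c i * F.κ i p) • D2 β p = ∑ j, r j • rowMap k m j)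
    (hZ : ∀ z z' : ι → k, ∑ t, z t • D1 β t = ∑ t, z' t • D1 β t → ∑ t, z t • D2 β t = ∑ t, z' t • D2 β t → z = z')
    (t : ι) :
    (∑ i, c i * β.w t i 0 + ∑ j, r j * β.w t j 1) = if t ∈ F.I then ∑ i, c i * F.κ i t else 0 := by
  classical
  have hκ' : ∀ (D : ι → Blk k m), ∑ t, (if t ∈ F.I then ∑ i, c i * F.κ i t else 0) • D t =
      ∑ p ∈ F.I, (∑ i, c i * F.κ i p) • D p := by
    intro D
    have e : ∀ t, (if t ∈ F.I then ∑ i, c i * F.κ i t else 0) • D t =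
        if t ∈ F.I then (∑ i, c i * F.κ i t) • D t else 0 := by
      intro t; split_ifs <;> simp
    simp_rw [e]
    rw [Finset.sum_ite_mem, Finset.univ_inter]
  have h1 : ∑ t, (∑ i, c i * β.w t i 0 + ∑ j, r j * β.w t j 1) • D1 β t =
      ∑ t, (if t ∈ F.I then ∑ i, c i * F.κ i t else 0) • D1 β t := by
    rw [hκ', sum_theta_smul_D1 F c r]
  have h2 : ∑ t, (∑ i, c i * β.w t i 0 + ∑ j, r j * β.w t j 1) • D2 β t =
      ∑ t, (if t ∈ F.I then ∑ i, c i * F.κ i t else 0) • D2 β t := by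
    rw [hκ', sum_theta_smul_D2 c r, hR]
  exact congrFun (hZ _ _ h1 h2) t

/-- **Consequence**: under the hypotheses of the mechanism (part 1) and linear independence of the products, every term `t` with
`θ_c(w_t) ≠ 0` is a member of `I'` with a RANK-ONE X-form (`q_t ∥ p_t`). In particular `θ_c` annihilates the output coefficients `w_t` of
all terms outside the frame, of the extra members `I ∖ I'`, and of all frame members with invertible X-form. -/
theorem theta_ne_zero_imp {I' : Finset ι} (hI'I : I' ⊆ F.I)
    (hI'indep : ∀ a : ι → k, ∑ p ∈ I', a p • β.f p = 0 → ∀ p ∈ I', a p = 0)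
    (c r : Fin m → k) (hR : ∑ p ∈ F.I, (∑ i, c i * F.κ i p) • D2 β p = ∑ j, r j • rowMap k m j)
    (ha : ∀ p ∈ F.I, p ∉ I' → (∑ i, c i * F.κ i p) = 0) (hc : ∀ p ∈ F.I, p ∉ I' → (∑ j, r j * F.κ j p) = 0)
    (hZ : ∀ z z' : ι → k, ∑ t, z t • D1 β t = ∑ t, z' t • D1 β t → ∑ t, z t • D2 β t = ∑ t, z' t • D2 β t → z = z')
    {t : ι} (ht : (∑ i, c i * β.w t i 0 + ∑ j, r j * β.w t j 1) ≠ 0) :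
    t ∈ I' ∧ ∃ a : k, qvec β t = a • pvec β t := by
  have hθ := theta_eq_of_indep F c r hR hZ t
  by_cases htI : t ∈ F.I
  · rw [if_pos htI] at hθ
    have htI' : t ∈ I' := by
      by_contra h
      exact ht (by rw [hθ, ha t htI h])
    refine ⟨htI', qvec_par_of_ne_zero F hI'I hI'indep c r hR ha hc htI' ?_⟩
    rw [← hθ]; exact ht
  · rw [if_neg htI] at hθ
    exact absurd hθ ht

end Lemma12Gen

end Summit.MatrixMultiplication.OmegaCensus.SmallFormats
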